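import Summits.Parity.BatemanHorn.Theorems.DiscMajorantLog.Negative.RightHalfLoadBearing
import Literature.NumberTheory.LFunctions.SatheSelbergFromSelbergDelange
import Literature.NumberTheory.LFunctions.SelbergDelangeTheoremHolds

/-!
# Crux `DiscMajorantLog` (stmt-Parity-17114) — `irreducible` is load-bearing on the RIGHT half-disc
(line `Sketch`), by a parity-free mechanism

Negative-side theorem (standing disprover `cdisprove-stmt-Parity-17114`, 2026-08-17), companion of
`RightHalfLoadBearing.lean` (engine `body_false_of_lower`; the other three clauses on the right half) and of
`LoadBearingClauses.lean` (p140268: the same witness `X²` on the LEFT half at `z = −1`, through parity).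

* `eventually_sum_four_pow_omega_ge` — Selberg–Delange at `z = 4`, lower half, along `ℕ`:
  `Σ_{1≤n≤x} 4^{ω(n)} ≥ (e^{−128}/12)·x (log x)³` for all large `x`, from the Selberg–Delange theorem
  PROVED in the tree (`MontgomeryVaughan2007_thm_7_18_holds`, `SatheSelberg.omegaMeanValue_of_thm_7_18`:
  main term `F_x(4)/Γ(4)·x (log x)³`, error `O(x (log x)²)`; `F_x(4) ≥ e^{−8·4²}` by
  `SatheSelberg.exp_neg_le_satheSelbergF`).
* `stub_rightHalf_false_without_irreducible` — DROP `irreducible` (members still NON-CONSTANT) ⇒ the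
  right-half-disc stub is FALSE: witness `![X²]` (statistic `2ω(n)`) at the real point `t = 2`:
  `S_x(2) ≥ Σ_{1≤n≤x} 4^{ω(n)} ≫ x (log x)³` against the claim `O(x log x)`.  Mechanism: `f = g²` squares
  the tilt (`z ↦ z²`), so the `t`-moment has harmonic exponent `t² − 1 > t − 1` — irreducibility enters the
  right stub through the multiplicity structure of `f`, not only through `ω_f(p) = k` on average.

With `RightHalfLoadBearing.lean`: all FOUR clauses of `IsBatemanHornSystem` are load-bearing on the right
half-disc (parity-free), as they are on the left half-disc (through parity, p136416/p140268).
-/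

noncomputable section

namespace Summit.Parity.BatemanHorn.Theorems.DiscMajorantLog.Negative

open Polynomial Filter Asymptotics
open Literature.NumberTheory.Sieve
open Summit.Parity.BatemanHorn.Theorems.SystemZeroRepulsion.Negative

/-! ## RIGHT half-disc: `irreducible` is load-bearing (witness `X²`, `t = 2`, Selberg–Delange at `z = 4`) -/

/-- Selberg–Delange at `z = 4`, lower half, along `ℕ`: `Σ_{1≤n≤x} 4^{ω(n)} ≥ (e^{−128}/12)·x (log x)³`
for all large `x` (main term `F_x(4)/Γ(4)·x (log x)³` with `F_x(4) ≥ e^{−8·4²}`, error `O(x (log x)²)`).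
[folklore] -/
theorem eventually_sum_four_pow_omega_ge :
    ∀ᶠ x : ℕ in atTop, Real.exp (-128) / 12 * (x : ℝ) * Real.log (x : ℝ) ^ 3 ≤
      ∑ n ∈ Finset.Icc 1 x, (4 : ℝ) ^ (ArithmeticFunction.cardDistinctFactors n) := by
  obtain ⟨C₁, hC₁⟩ := Literature.NumberTheory.LFunctions.SatheSelberg.omegaMeanValue_of_thm_7_18
    Literature.NumberTheory.LFunctions.MontgomeryVaughan2007_thm_7_18_holds 4 (by norm_num)
  have hlogT : Tendsto (fun x : ℕ => Real.log (x : ℝ)) atTop atTop :=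
    Real.tendsto_log_atTop.comp tendsto_natCast_atTop_atTop
  filter_upwards [eventually_ge_atTop 2, hlogT.eventually_ge_atTop (12 * |C₁| * Real.exp 128 + 1)]
    with x hx2 hxlog
  have hx2R : (2 : ℝ) ≤ x := by exact_mod_cast hx2
  have hSD := hC₁ x hx2 4 (by simp)
  -- the main term is real
  have hF : Literature.NumberTheory.LFunctions.satheSelbergFC x 4 =
      ((Literature.NumberTheory.LFunctions.satheSelbergF x 4 : ℝ) : ℂ) := by
    rw [← Literature.NumberTheory.LFunctions.satheSelbergFC_ofReal]; norm_num
  have hΓ : Complex.Gamma 4 = 6 := by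
    rw [show (4 : ℂ) = (3 : ℕ) + 1 by norm_num, Complex.Gamma_nat_eq_factorial]
    simp [Nat.factorial]
  have hL : ((Real.log x : ℝ) : ℂ) ^ ((4 : ℂ) - 1) = ((Real.log x ^ 3 : ℝ) : ℂ) := by
    rw [show (4 : ℂ) - 1 = ((3 : ℕ) : ℂ) by norm_num, Complex.cpow_natCast]; push_cast; ring
  have hmainR : Literature.NumberTheory.LFunctions.satheSelbergFC x 4 / Complex.Gamma 4 * (x : ℂ) *
      (((Real.log x : ℝ) : ℂ) ^ ((4 : ℂ) - 1)) =
        ((Literature.NumberTheory.LFunctions.satheSelbergF x 4 / 6 * x * Real.log x ^ 3 : ℝ) : ℂ) := by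
    rw [hF, hΓ, hL]; push_cast; ring
  have hsumR : (∑ n ∈ Finset.Icc 1 x, (4 : ℂ) ^ (ArithmeticFunction.cardDistinctFactors n)) =
      ((∑ n ∈ Finset.Icc 1 x, (4 : ℝ) ^ (ArithmeticFunction.cardDistinctFactors n) : ℝ) : ℂ) := by
    push_cast; rfl
  rw [hmainR, hsumR, ← Complex.ofReal_sub, Complex.norm_real, Real.norm_eq_abs,
    show (4 : ℂ).re - 2 = ((2 : ℕ) : ℝ) by simp; norm_num, Real.rpow_natCast] at hSD
  have hlow := (abs_le.mp hSD).1
  -- constants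
  set L : ℝ := Real.log x with hLdef
  set Fx : ℝ := Literature.NumberTheory.LFunctions.satheSelbergF x 4 with hFx
  have hFpos : Real.exp (-128) ≤ Fx := by
    have := Literature.NumberTheory.LFunctions.SatheSelberg.exp_neg_le_satheSelbergF x (by norm_num : (0 : ℝ) ≤ 4)
    norm_num at this
    exact this
  have he : Real.exp (-128) * Real.exp 128 = 1 := by rw [← Real.exp_add]; norm_num
  have hepos : 0 < Real.exp (-128) := Real.exp_pos _
  have hLpos : 0 < L := Real.log_pos (by linarith)
  have hxpos : (0 : ℝ) < x := by linarith
  have hC : C₁ ≤ Real.exp (-128) / 12 * L := by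
    calc C₁ ≤ |C₁| := le_abs_self _
      _ = Real.exp (-128) / 12 * (12 * |C₁| * Real.exp 128) := by
          rw [show Real.exp (-128) / 12 * (12 * |C₁| * Real.exp 128) =
            |C₁| * (Real.exp (-128) * Real.exp 128) by ring, he, mul_one]
      _ ≤ Real.exp (-128) / 12 * L :=
          mul_le_mul_of_nonneg_left (by linarith) (by positivity)
  have h1 : Real.exp (-128) / 6 * ((x : ℝ) * L ^ 3) ≤ Fx / 6 * ((x : ℝ) * L ^ 3) :=
    mul_le_mul_of_nonneg_right (by linarith) (by positivity)
  have h2 : C₁ * x * L ^ 2 ≤ Real.exp (-128) / 12 * x * L ^ 3 := by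
    calc C₁ * x * L ^ 2 = C₁ * ((x : ℝ) * L ^ 2) := by ring
      _ ≤ Real.exp (-128) / 12 * L * ((x : ℝ) * L ^ 2) := mul_le_mul_of_nonneg_right hC (by positivity)
      _ = Real.exp (-128) / 12 * x * L ^ 3 := by ring
  nlinarith

/-- DROP `irreducible` ⇒ the RIGHT-half-disc stub is FALSE, even with every member NON-CONSTANT — and by a
PARITY-FREE mechanism: witness `k = 1`, `f = ![X²]` (leading coefficient `1 > 0`, vacuously pairwise
non-associated, `ω(p) = 1 < p`), statistic `2ω(n)`, at the real point `t = 2` (`‖t − 1‖ = 1`):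
`S_x(2) = 1 + Σ_{1≤n≤x} 4^{ω(n)} ≥ (e^{−128}/12)·x (log x)³` (Selberg–Delange at `z = 4`, PROVED in the
tree: `MontgomeryVaughan2007_thm_7_18_holds`), against the claim `A e^{C log 3} x (log x)^{1}`.  The square
`f = g²` squares the tilt (`z ↦ z²`), so the `t`-moment has harmonic exponent `t² − 1 > t − 1`: any proof of
the right stub must use irreducibility through the multiplicity structure of `f`, not only through the mean
`ω_f(p) = k` on average (which `X²` has).  Companion of `discMajorantLog_false_without_irreducible`
(p140268: the same witness on the LEFT half at `z = −1`, through parity). [folklore] -/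
theorem stub_rightHalf_false_without_irreducible :
    ¬ ∀ (k : ℕ) (f : Fin k → ℤ[X]), (∀ i, 0 < (f i).natDegree) → (∀ i, 0 < (f i).leadingCoeff) →
      (Pairwise fun i j => ¬Associated (f i) (f j)) → HasNoFixedPrimeDivisor f →
      ∃ A C : ℝ, ∃ x₀ : ℕ, ∀ x : ℕ, x₀ ≤ x → ∀ z : ℂ, ‖z - 1‖ ≤ 3 * Real.log (Real.log (x : ℝ)) →
        0 ≤ z.re →
        ‖(∑ n ∈ Finset.range (x + 1), (z : ℂ) ^ (∑ i, (((f i).eval (n : ℤ)).toNat.factorization.sum fun _ v => min v 2)))‖ ≤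
          A * (x : ℝ) * (Real.log (x : ℝ)) ^ ((k : ℝ) * ((z : ℂ).re - 1)) *
            Real.exp (C * ‖(z : ℂ) - 1‖ * Real.log (‖(z : ℂ) - 1‖ + 2)) := by
  intro h
  have hdeg : ∀ i : Fin 1, 0 < ((![X ^ 2] : Fin 1 → ℤ[X]) i).natDegree := by
    intro i; fin_cases i; simp
  refine body_false_of_lower (k := 1) (Q := fun z : ℂ => 0 ≤ z.re) (z₀ := ((2 : ℝ) : ℂ)) (β := -3)
    (c := Real.exp (-128) / 12)
    (F := fun (x : ℕ) (z : ℂ) => ‖∑ n ∈ Finset.range (x + 1), (z : ℂ) ^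
      (∑ i, ((((![X ^ 2] : Fin 1 → ℤ[X]) i).eval (n : ℤ)).toNat.factorization.sum fun _ v => min v 2))‖)
    ?_ ?_ (by positivity) ?_ ?_ (h 1 ![X ^ 2] hdeg sqX_leadingCoeff_pos sqX_pairwise sqX_hasNoFixedPrimeDivisor)
  · rw [show ((2 : ℝ) : ℂ) - 1 = ((1 : ℝ) : ℂ) by push_cast; norm_num, Complex.norm_real]; norm_num
  · simp only [Complex.ofReal_re]; norm_num
  · simp only [Complex.ofReal_re, Nat.cast_one]; norm_num
  · filter_upwards [eventually_sum_four_pow_omega_ge, eventually_ge_atTop 2] with x hx hx2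
    have hx2R : (2 : ℝ) ≤ x := by exact_mod_cast hx2
    have hLpos : 0 < Real.log (x : ℝ) := Real.log_pos (by linarith)
    have hterm : ∀ n ∈ Finset.range (x + 1), (((2 : ℝ) : ℂ)) ^
        (∑ i : Fin 1, ((((![X ^ 2] : Fin 1 → ℤ[X]) i).eval (n : ℤ)).toNat.factorization.sum fun _ v => min v 2)) =
          (((2 : ℝ) : ℂ)) ^ (2 * n.primeFactors.card) := by
      intro n _
      rw [sqX_exponent]
    rw [Finset.sum_congr rfl hterm, norm_sum_ofReal_pow _ _ (by norm_num),
      Real.rpow_neg hLpos.le, show (3 : ℝ) = ((3 : ℕ) : ℝ) by norm_num, Real.rpow_natCast, div_inv_eq_mul]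
    have hsub : Finset.Icc 1 x ⊆ Finset.range (x + 1) := by
      intro n hn
      simp only [Finset.mem_Icc] at hn
      simp only [Finset.mem_range]
      omega
    have hle : ∑ n ∈ Finset.Icc 1 x, (4 : ℝ) ^ (ArithmeticFunction.cardDistinctFactors n) ≤
        ∑ n ∈ Finset.range (x + 1), (2 : ℝ) ^ (2 * n.primeFactors.card) := by
      calc ∑ n ∈ Finset.Icc 1 x, (4 : ℝ) ^ (ArithmeticFunction.cardDistinctFactors n)
          = ∑ n ∈ Finset.Icc 1 x, (2 : ℝ) ^ (2 * n.primeFactors.card) :=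
            Finset.sum_congr rfl fun n _ => by
              rw [pow_mul, ArithmeticFunction.cardDistinctFactors_apply, ← Nat.toFinset_factors,
                List.card_toFinset]
              norm_num
        _ ≤ _ := Finset.sum_le_sum_of_subset_of_nonneg hsub fun _ _ _ => by positivity
    linarith

end Summit.Parity.BatemanHorn.Theorems.DiscMajorantLog.Negative
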